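import Summits.MatrixMultiplication.MatrixMultiplication.Theses.TetrahedronCarving
import Summits.MatrixMultiplication.MatrixMultiplication.Theorems.EdgePencilPlusTwoCut
import HarnessLib

/-!
# TetrahedronCarvingAlphaPos — the support fact `α > 0` of route `TetrahedronCarving`, by name

(decomp-mm cell, landing bookkeeping for route `TetrahedronCarving` rev 8; mathematics = Coppersmith
1982 as vendored in `Literature.Computability.AlgebraicComplexity.Coppersmith1982RapidRectangular`,
surfaced for the route by lens 6, generation 22, `Theorems.EdgePencil.alphaPos`.)

Route item `AlphaPos` (aside, support fact): `0 < α(ℂ)`, the dual exponent of rectangular matrix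
multiplication is positive (Coppersmith 1982: `α > 0.172`; tree theorem
`coppersmith1982_dualExponentAlpha_gt : 0.1722 < α`, every field, certificate-checked). It is the
price of the one-notch weakenings of the route's cut (the `(1,1)` cut `TetraExcessZero →
TetraPlusTwo → ω = 2` and the `(2,2)` cut, `Theorems.EdgePencilDefectCuts` /
`Theorems.EdgePencilPlusTwoCut`). This file closes the item BY NAME; its statement is the route
definition `AlphaPos` literally. No new mathematics.

References: [cite: Coppersmith1982, Thm. 1]; Le Gall 2012 §1 (`α`); arXiv:1609.07476 §1.3.
-/

set_option linter.dupNamespace false -- `MatrixMultiplication.MatrixMultiplication` (summit = problem, D-0017)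

noncomputable section

open Summit.MatrixMultiplication.MatrixMultiplication.Theses.TetrahedronCarving

namespace Summit.MatrixMultiplication.MatrixMultiplication.Theorems.TetrahedronCarvingAlphaPos

/-- **Item `AlphaPos`**: `0 < α(ℂ)` — the dual exponent of rectangular matrix multiplication is
positive (Coppersmith 1982, `α > 0.1722`). [cite: Coppersmith1982, Thm. 1] -/
theorem alphaPos_holds : AlphaPos :=
  Summit.MatrixMultiplication.MatrixMultiplication.Theorems.EdgePencil.alphaPos

end Summit.MatrixMultiplication.MatrixMultiplication.Theorems.TetrahedronCarvingAlphaPos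

end
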